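import Literature.Computability.Cryptography.LiuPassCondFamily
import Literature.Computability.Cryptography.LiuPassCondGenProgram
import Literature.Computability.Cryptography.LiuPassPaddingProofs
import Literature.Computability.Cryptography.LiuPassLemma53AssemblyProofs
import HarnessLib

/-!
# Discharge of the facts of `LiuPassCondFamily.lean`: the two efficiency facts, and Thm 5.5 with its running-time clause

`LiuPassCondFamily.lean` proves the named fact `condEPPRG_family_of_OWFExist` (Liu–Pass FOCS 2020,
Thm 5.6 with the truncations and eq. (2) of the proof of Thm 5.2, for the tree's universal machine)
from Thm 5.5 with its running-time clause (`condEPPRG_uniform_of_OWFExist`), the pass-through fact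
(proved in `LiuPassPaddingProofs.lean`) and two efficiency facts, vendored there as named `Prop`s.
This file proves both efficiency facts, so that the family fact rests on the uniform Thm 5.5 alone
(`condEPPRG_family_of_OWFExist_of_uniform`):

* `famGen_polyTime_holds : famGen_polyTime` — the padded generators
  `s ↦ F(s_{<n₁}) ‖ (s_{≥n₁})_{<b}` are polynomial time: an `FP` pipeline (`FamProg.genF`) of the
  unary-arithmetic bricks of `LiuPassCondRedProgram.lean` (`logU`, `innerU`), `divModFn`,
  `binToUnaryFn` (the power of two `2^{⌊⌊log₂ N⌋/D⌋}` as the value of the numeral `0^j 1`, capped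
  by the ruler `s`, which is exactly `lpFamIn`), `takeFn`/`dropFn`/`concatFn`;
* `famRedRun_polyTime_holds : famRedRun_polyTime` — the deterministic core of the reduction's
  distinguisher is polynomial time: the `FP` pipeline `FamProg.redF` (unary coin count, `A(n)`,
  `K(n)` by `polyFn`, the division with remainder by `divModFn`, the outer length `1^N`, the pad
  by the same bricks as the generator, `take`/`drop`, and the outer distinguisher on
  `⟨⟨1^N, x⟩, ρ⟩`), transported to the pair presentation as for `lpAdvRun_polyTime_holds`.

As in `LiuPassCondGenProgram.lean` no machine is programmed; values of the pipelines are computed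
by `simp` from the bricks' specifications (`FamProg.genF_apply`, `FamProg.redF_boolPair`).

The second part of the file proves **Thm 5.5 with its running-time clause** itself,
`condEPPRG_uniform_of_OWFExist_holds : condEPPRG_uniform_of_OWFExist` (print, proof of Thm 5.5, last
paragraph: "there exists some polynomial `t₀(n')` such that for every `δ, γ > 1`, `(γ + δ)t₀(n')` bounds
the running time of `G'_{δ,γ}` … the OWF used in this construction can be assumed to have some fixed
polynomial running time … for any `γ, δ`, `G'` runs in `poly(n) + O(n^{c+1}) + (γ+δ)O(n^c log n)`
time"), whence the family fact and the tree's Thm 5.5 unconditionally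
(`condEPPRG_family_of_OWFExist_holds`, `condEPPRG_of_OWFExist_holds`):

* `UnifProg.FFu`, `UnifProg.HcFu` — Lemma 5.3's family `f'_i` and hard-core function `GL`
  (`L53Params.F`, `L53Params.Hc` of `LiuPassLemma53Defs.lean`) as `FP` pipelines on
  `⟨1^{α'}, ⟨1^{γ'}, ⟨1ⁱ, w⟩⟩⟩`, i.e. *uniformly in the parameters `α', γ'`*: the pipelines
  `L53Prog.FF`, `L53Prog.HcF` of `LiuPassLemma53Programs.lean` with the two constants `1^{γ'}`,
  `1^{2α'}` replaced by projections of the input (`FFu_apply`, `HcFu_apply`, `FFu_mem_FP`, `HcFu_mem_FP`);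
* `UnifProg.uParams f P γ δ` — the data of Thm 5.5's construction for the member `(γ, δ)` (`c = deg P + 3`
  for a polynomial bound `P` on `|f x|`, `α' = 2(2c + cδ + 1)`, `γ' = 2α' + 8(c+1)(γ+1)`, the regularity
  index `lpRegIdx f` of Lemma 5.4, and `f'_i`, `GL` for `(α', γ')`), and `UnifProg.GuF f P` — **one** `FP`
  pipeline on `⟨1^γ, ⟨1^δ, u⟩⟩` computing `CondParams.G (uParams f P γ δ) u` (`GuF_apply`: the pipeline
  `CondGen.GF` of `LiuPassCondGenProgram.lean` with `1^{2α'}`, `1^{γ'}`, `1^{|u| + γ⌊log₂|u|⌋}` computed from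
  the tags; `GuF_mem_FP`);
* `UnifProg.isCondEPPRG_uParams` — each member is a `1/n^δ`-cond EP-PRG of stretch `γ⌊log₂ n⌋`: the
  tree's proof of Thm 5.5 (`LiuPassCondFromRegular.lean`, `LiuPassLemma53Assembly.lean`) for this explicit
  data, with the Goldreich–Levin theorem proved in the tree (`GLInv.goldreichLevin_hiding_len_of_eff`,
  `GLInv.glInvRun_polyTime_holds`);
* `condEPPRG_uniform_of_OWFExist_holds` (`Gu = GuF f P`, `lpTagged_GuF`), `condEPPRG_of_OWFExist_holds`,
  `condEPPRG_family_of_OWFExist_holds`.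

## References

* Y. Liu, R. Pass, *On one-way functions and Kolmogorov complexity*, FOCS 2020, 1243–1254
  (doi:10.1109/FOCS46700.2020.00118; arXiv:2009.11514v1, §5.3, pp. 14–15), Thm 5.5 and its proof
  (running time: last paragraph), Thm 5.6 (padding), Lemmas 5.3–5.4.
* S. Arora, B. Barak, *Computational Complexity: A Modern Approach*, CUP 2009, §1.3, §1.4.1.
-/

namespace Literature.Computability.Cryptography

open _root_.Computability Polynomial Complexity Complexity.Brick Complexity.Plumb Complexity.OracleCompose

namespace FamProg

open CondRed

/-! ### The lengths of the family in unary -/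

section Lengths

variable (γ₀ D c : ℕ)

/-- `jU u = 1^{⌊⌊log₂ |u|⌋ / D⌋}`. [folklore] -/
noncomputable def jU : List Bool → List Bool := fstF ∘ divModFn ∘ fanoutFn (fun _ => ones D) logU

/-- The little-endian binary numeral `0^j 1` of `2^j`, `j = ⌊⌊log₂ |u|⌋ / D⌋`. [folklore] -/
noncomputable def pow2F : List Bool → List Bool :=
  concatFn ∘ fanoutFn (Kannan.zerosFn ∘ jU D) (fun _ => [true])

/-- **`n1U u = 1^{lpFamIn D |u|}`**: the numeral of `2^j` converted to unary, capped by the ruler `u`.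
[Y. Liu, R. Pass, FOCS 2020, proof of Thm 5.6 (`|s₁| = n^{1/2c₀}`)] [folklore] -/
noncomputable def n1U : List Bool → List Bool := binToUnaryFn ∘ fanoutFn id (pow2F D)

/-- `lenU u = 1^{|u| + 6⌊log₂ |u|⌋ - c}` (`lpFamLen`). [folklore] -/
noncomputable def lenU : List Bool → List Bool :=
  dropFn ∘ fanoutFn (fun _ => ones c)
    (concatFn ∘ fanoutFn onesFn (HashBricks.umulFn ∘ fanoutFn (fun _ => ones 6) logU))

/-- `padU u = 1^{lpFamPad γ₀ D c |u|}`. [folklore] -/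
noncomputable def padU : List Bool → List Bool := dropFn ∘ fanoutFn (innerU γ₀ ∘ n1U D) (lenU c)

variable {γ₀ D c}

/-- `bitsToNat (0^j 1) = 2^j` (private copy of `TodaPartTwo.bitsToNat_zeros_one`, whose module is not in
this file's import closure). [folklore] -/
private theorem bitsToNat_zeros_true (j : ℕ) : bitsToNat (List.replicate j false ++ [true]) = 2 ^ j := by
  rw [bitsToNat_append]
  simp

/-- Value of `jU`. [folklore] -/
@[simp] theorem jU_apply (u : List Bool) : jU D u = ones (Nat.log 2 u.length / D) := by
  simp only [jU, Function.comp_apply, fanoutFn_apply, logU_apply, divModFn_boolPair, fstF_boolPair]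

/-- Value of `pow2F`. [folklore] -/
@[simp] theorem pow2F_apply (u : List Bool) :
    pow2F D u = List.replicate (Nat.log 2 u.length / D) false ++ [true] := by
  simp only [pow2F, Function.comp_apply, fanoutFn_apply, jU_apply, Kannan.zerosFn_apply, List.length_replicate,
    concatFn_boolPair]

/-- **Value of `n1U`.** [folklore] -/
@[simp] theorem n1U_apply (u : List Bool) : n1U D u = ones (lpFamIn D u.length) := by
  simp only [n1U, Function.comp_apply, fanoutFn_apply, id, pow2F_apply, binToUnaryFn_boolPair, bitsToNat_zeros_true,
    lpFamIn, Nat.min_comm]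

/-- Value of `lenU`. [folklore] -/
@[simp] theorem lenU_apply (u : List Bool) : lenU c u = ones (lpFamLen c u.length) := by
  simp only [lenU, Function.comp_apply, fanoutFn_apply, onesFn_eq_ones, logU_apply, HashBricks.umulFn_boolPair,
    concatFn_boolPair, Com.ones_append, dropFn_boolPair, List.length_replicate, Com.drop_ones, lpFamLen]

/-- **Value of `padU`.** [folklore] -/
@[simp] theorem padU_apply (u : List Bool) : padU γ₀ D c u = ones (lpFamPad γ₀ D c u.length) := by
  simp only [padU, Function.comp_apply, fanoutFn_apply, n1U_apply, innerU_apply, List.length_replicate, lenU_apply,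
    dropFn_boolPair, Com.drop_ones, lpFamPad]

/-- `jU ∈ FP`. [folklore] -/
theorem jU_mem_FP : jU D ∈ FP :=
  comp_mem_FP fstF_mem_FP (comp_mem_FP divModFn_mem_FP (fanoutFn_mem_FP (const_mem_FP _) logU_mem_FP))

/-- `pow2F ∈ FP`. [folklore] -/
theorem pow2F_mem_FP : pow2F D ∈ FP :=
  comp_mem_FP concatFn_mem_FP (fanoutFn_mem_FP (comp_mem_FP Kannan.zerosFn_mem_FP jU_mem_FP) (const_mem_FP _))

/-- `n1U ∈ FP`. [folklore] -/
theorem n1U_mem_FP : n1U D ∈ FP :=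
  comp_mem_FP binToUnaryFn_mem_FP (fanoutFn_mem_FP OracleCompose.id_mem_FP pow2F_mem_FP)

/-- `lenU ∈ FP`. [folklore] -/
theorem lenU_mem_FP : lenU c ∈ FP :=
  comp_mem_FP dropFn_mem_FP (fanoutFn_mem_FP (const_mem_FP _) (comp_mem_FP concatFn_mem_FP
    (fanoutFn_mem_FP onesFn_mem_FP (comp_mem_FP HashBricks.umulFn_mem_FP
      (fanoutFn_mem_FP (const_mem_FP _) logU_mem_FP)))))

/-- `padU ∈ FP`. [folklore] -/
theorem padU_mem_FP : padU γ₀ D c ∈ FP :=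
  comp_mem_FP dropFn_mem_FP (fanoutFn_mem_FP (comp_mem_FP (innerU_mem_FP _) n1U_mem_FP) lenU_mem_FP)

end Lengths

/-! ### The generator as a pipeline -/

section Gen

variable (γ₀ D c : ℕ) (F : List Bool → List Bool)

/-- The inner seed `s_{< n₁}`. [folklore] -/
noncomputable def s1F : List Bool → List Bool := takeFn ∘ fanoutFn (n1U D) id
/-- The rest `s_{≥ n₁}`. [folklore] -/
noncomputable def restF : List Bool → List Bool := dropFn ∘ fanoutFn (n1U D) id
/-- The pass-through block `(s_{≥ n₁})_{< b}`. [folklore] -/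
noncomputable def tauF : List Bool → List Bool := takeFn ∘ fanoutFn (padU γ₀ D c) (restF D)
/-- **The member `c` of the family as a pipeline**: `F(s_{<n₁}) ‖ (s_{≥n₁})_{<b}`.
[Y. Liu, R. Pass, FOCS 2020, proof of Thm 5.6] [folklore] -/
noncomputable def genF : List Bool → List Bool := concatFn ∘ fanoutFn (F ∘ s1F D) (tauF γ₀ D c)

variable {γ₀ D c F}

/-- **The pipeline computes `famGen`.** [folklore] -/
theorem genF_apply (u : List Bool) : genF γ₀ D c F u = famGen F γ₀ D c u := by
  simp only [genF, s1F, restF, tauF, Function.comp_apply, fanoutFn_apply, n1U_apply, padU_apply, id,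
    takeFn_boolPair, dropFn_boolPair, List.length_replicate, concatFn_boolPair, famGen]

/-- `genF ∈ FP` for `F ∈ FP`. [folklore] -/
theorem genF_mem_FP (hF : F ∈ FP) : genF γ₀ D c F ∈ FP :=
  comp_mem_FP concatFn_mem_FP (fanoutFn_mem_FP
    (comp_mem_FP hF (comp_mem_FP takeFn_mem_FP (fanoutFn_mem_FP n1U_mem_FP OracleCompose.id_mem_FP)))
    (comp_mem_FP takeFn_mem_FP (fanoutFn_mem_FP padU_mem_FP
      (comp_mem_FP dropFn_mem_FP (fanoutFn_mem_FP n1U_mem_FP OracleCompose.id_mem_FP)))))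

end Gen

/-! ### The reduction's distinguisher as a pipeline -/

section Red

variable (γ₀ D c : ℕ) (A K : Polynomial ℕ) (h : List Bool → List Bool)

/-- The first component `a` of the input `z = ⟨a, y⟩` (only its length `n` matters). [folklore] -/
noncomputable def aF : List Bool → List Bool := fstF ∘ fstF
/-- The sample `y`. [folklore] -/
noncomputable def yF : List Bool → List Bool := sndF ∘ fstF
/-- The coin count in unary, `1^{|r|}`. [folklore] -/
noncomputable def CU : List Bool → List Bool := onesFn ∘ sndF
/-- `⟨1^i, 1^κ⟩` with `|r| - A(n) = i · K(n) + κ`. [folklore] -/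
noncomputable def dmF : List Bool → List Bool :=
  divModFn ∘ fanoutFn (polyFn K ∘ aF) (dropFn ∘ fanoutFn (polyFn A ∘ aF) CU)
/-- The outer length `1^N`, `N = n^D + i`. [folklore] -/
noncomputable def NU : List Bool → List Bool := concatFn ∘ fanoutFn (polyFn (X ^ D) ∘ aF) (fstF ∘ dmF A K)
/-- The padded sample `x = y ‖ r_{< b(N)}`. [folklore] -/
noncomputable def xF : List Bool → List Bool :=
  concatFn ∘ fanoutFn yF (takeFn ∘ fanoutFn (padU γ₀ D c ∘ NU D A K) sndF)
/-- The outer distinguisher's coins `ρ = r_{≥ |r| - κ}`. [folklore] -/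
noncomputable def rhoF : List Bool → List Bool :=
  dropFn ∘ fanoutFn (dropFn ∘ fanoutFn (sndF ∘ dmF A K) CU) sndF
/-- **The reduction's distinguisher as a string function** on `⟨z, r⟩`, for a string function `h`
playing `⟨⟨1^N, x⟩, ρ⟩ ↦ encodeBool (Dg(1^N, x; ρ))`. [Y. Liu, R. Pass, FOCS 2020, proof of Thm 5.6
(reduction to the inner generator)] [folklore] -/
noncomputable def redF : List Bool → List Bool :=
  h ∘ fanoutFn (fanoutFn (NU D A K) (xF γ₀ D c A K)) (rhoF A K)

variable {γ₀ D c A K h}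

/-- `dmF ∈ FP`. [folklore] -/
theorem dmF_mem_FP : dmF A K ∈ FP :=
  comp_mem_FP divModFn_mem_FP (fanoutFn_mem_FP
    (comp_mem_FP (polyFn_mem_FP _) (comp_mem_FP fstF_mem_FP fstF_mem_FP))
    (comp_mem_FP dropFn_mem_FP (fanoutFn_mem_FP
      (comp_mem_FP (polyFn_mem_FP _) (comp_mem_FP fstF_mem_FP fstF_mem_FP))
      (comp_mem_FP onesFn_mem_FP sndF_mem_FP))))

/-- `NU ∈ FP`. [folklore] -/
theorem NU_mem_FP : NU D A K ∈ FP :=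
  comp_mem_FP concatFn_mem_FP (fanoutFn_mem_FP
    (comp_mem_FP (polyFn_mem_FP _) (comp_mem_FP fstF_mem_FP fstF_mem_FP)) (comp_mem_FP fstF_mem_FP dmF_mem_FP))

/-- `xF ∈ FP`. [folklore] -/
theorem xF_mem_FP : xF γ₀ D c A K ∈ FP :=
  comp_mem_FP concatFn_mem_FP (fanoutFn_mem_FP (comp_mem_FP sndF_mem_FP fstF_mem_FP)
    (comp_mem_FP takeFn_mem_FP (fanoutFn_mem_FP (comp_mem_FP padU_mem_FP NU_mem_FP) sndF_mem_FP)))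

/-- `rhoF ∈ FP`. [folklore] -/
theorem rhoF_mem_FP : rhoF A K ∈ FP :=
  comp_mem_FP dropFn_mem_FP (fanoutFn_mem_FP (comp_mem_FP dropFn_mem_FP (fanoutFn_mem_FP
    (comp_mem_FP sndF_mem_FP dmF_mem_FP) (comp_mem_FP onesFn_mem_FP sndF_mem_FP))) sndF_mem_FP)

/-- **`redF … h ∈ FP` for `h ∈ FP`.** [Arora–Barak 2009, §1.3] [folklore] -/
theorem redF_mem_FP (hh : h ∈ FP) : redF γ₀ D c A K h ∈ FP :=
  comp_mem_FP hh (fanoutFn_mem_FP (fanoutFn_mem_FP NU_mem_FP xF_mem_FP) rhoF_mem_FP)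

/-- **Value of the reduction's function** on `⟨z, r⟩`: with `n = |(boolUnpair z).1|`,
`y = (boolUnpair z).2`, `N = famOuter D A K n |r|`, `κ = famKap A K n |r|`, it is
`h ⟨⟨1^N, y ‖ r_{< b(N)}⟩, r_{≥ |r| - κ}⟩`. [folklore] -/
theorem redF_boolPair (z r : List Bool) :
    redF γ₀ D c A K h (boolPair z r) =
      h (boolPair (boolPair (ones (famOuter D (fun n => A.eval n) (fun n => K.eval n) (boolUnpair z).1.length r.length))
          ((boolUnpair z).2 ++ r.take (lpFamPad γ₀ D c
            (famOuter D (fun n => A.eval n) (fun n => K.eval n) (boolUnpair z).1.length r.length))))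
        (r.drop (r.length - famKap (fun n => A.eval n) (fun n => K.eval n) (boolUnpair z).1.length r.length))) := by
  have hz : fstF (boolPair z r) = z := fstF_boolPair z r
  have hfst : fstF z = (boolUnpair z).1 := rfl
  have hsnd : sndF z = (boolUnpair z).2 := rfl
  simp only [redF, NU, xF, rhoF, dmF, aF, yF, CU, Function.comp_apply, fanoutFn_apply, hz, hfst, hsnd, sndF_boolPair,
    onesFn_eq_ones, polyFn_apply, dropFn_boolPair, List.length_replicate, Com.drop_ones, divModFn_boolPair,
    fstF_boolPair, concatFn_boolPair, Com.ones_append, eval_pow, eval_X, padU_apply, takeFn_boolPair, famOuter, famKap]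

end Red

end FamProg

/-! ### The two efficiency facts and the family fact from the uniform Thm 5.5 alone -/

/-- **Discharge of `famGen_polyTime`**: the padded generators of the family are polynomial time
(the `FP` pipeline `FamProg.genF`). [Y. Liu, R. Pass, FOCS 2020, Thm 5.6 (running time of `G_γ`)]
[cite: LiuPassFOCS2020, Thm 5.6 (proof)] -/
theorem famGen_polyTime_holds : famGen_polyTime := by
  intro F hF γ₀ D c
  have heq : famGen F γ₀ D c = FamProg.genF γ₀ D c F := funext fun u => (FamProg.genF_apply u).symm
  show famGen F γ₀ D c ∈ FP
  rw [heq]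
  exact FamProg.genF_mem_FP hF

/-- **Discharge of `famRedRun_polyTime`**: the deterministic core of the reduction's distinguisher
is polynomial time, as the string function `FamProg.redF … h` with
`h = encodeBool ∘ uncurry Dg.run ∘ boolUnpair` (polynomial time by `IsPPT Dg encodeBool` and
`polyTimeComputable_boolUnpair`), transported to the pair presentation.
[Y. Liu, R. Pass, FOCS 2020, proof of Thm 5.6] [cite: LiuPassFOCS2020, Thm 5.6 (proof)] -/
theorem famRedRun_polyTime_holds : famRedRun_polyTime := by
  intro Dg hDg γ₀ D c A K
  -- `⟨x', ρ⟩ ↦ encodeBool (Dg(x'; ρ))` is in `FP`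
  have h1 : PolyTimeComputable (fun p : List Bool × List Bool => boolPair p.1 p.2) (id : List Bool → List Bool)
      (fun p : List Bool × List Bool => encodeBool (Dg.run p.1 p.2)) := by
    obtain ⟨p, M, hM⟩ := hDg.1
    exact ⟨p, M, fun a => hM a⟩
  have hh : ((fun p : List Bool × List Bool => encodeBool (Dg.run p.1 p.2)) ∘ boolUnpair) ∈ FP :=
    PolyTimeComputable.comp_holds h1 polyTimeComputable_boolUnpair
  obtain ⟨p, M, hM⟩ := FamProg.redF_mem_FP (γ₀ := γ₀) (D := D) (c := c) (A := A) (K := K) hh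
  refine ⟨p, M, fun q => ?_⟩
  have hrun := hM (boolPair q.1 q.2)
  have hval := FamProg.redF_boolPair (γ₀ := γ₀) (D := D) (c := c) (A := A) (K := K)
    (h := (fun p : List Bool × List Bool => encodeBool (Dg.run p.1 p.2)) ∘ boolUnpair) q.1 q.2
  simp only [id_eq] at hrun
  rw [hval, Function.comp_apply, boolUnpair_boolPair] at hrun
  have hrr : famRedRun Dg γ₀ D c (fun n => A.eval n) (fun n => K.eval n) q.1 q.2 =
      Dg.run (boolPair (ones (famOuter D (fun n => A.eval n) (fun n => K.eval n) (boolUnpair q.1).1.length q.2.length))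
          ((boolUnpair q.1).2 ++ q.2.take (lpFamPad γ₀ D c
            (famOuter D (fun n => A.eval n) (fun n => K.eval n) (boolUnpair q.1).1.length q.2.length))))
        (q.2.drop (q.2.length - famKap (fun n => A.eval n) (fun n => K.eval n) (boolUnpair q.1).1.length q.2.length)) := by
    rw [famRedRun, CondRed.unaryEncodeNat_eq_ones]
  show M.OutputsWithin (boolPair q.1 q.2) (encodeBool (famRedRun Dg γ₀ D c (fun n => A.eval n) (fun n => K.eval n) q.1 q.2)) _
  rw [hrr]
  exact hrun

/-- **The covering family (`condEPPRG_family_of_OWFExist`) from Thm 5.5 with its running-time clause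
alone**: the pass-through fact and both efficiency facts are discharged (`passThrough_polyTime_holds`,
`famGen_polyTime_holds`, `famRedRun_polyTime_holds`). [Y. Liu, R. Pass, FOCS 2020, Thm 5.6; proof of
Thm 5.2 (¶1, eq. (2))] [cite: LiuPassFOCS2020, Thm 5.6] -/
theorem condEPPRG_family_of_OWFExist_of_uniform (h55 : condEPPRG_uniform_of_OWFExist) :
    condEPPRG_family_of_OWFExist :=
  condEPPRG_family_of_OWFExist_of_facts h55 passThrough_polyTime_holds famGen_polyTime_holds famRedRun_polyTime_holds

/-! ## Thm 5.5 with its running-time clause: one polynomial-time function computing the whole family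

Input formats: `q = ⟨1^{α'}, ⟨1^{γ'}, ⟨1ⁱ, w⟩⟩⟩` for Lemma 5.3's maps (`UnifProg.FFu`, `UnifProg.HcFu`),
`z = ⟨1^γ, ⟨1^δ, u⟩⟩` for the generator (`UnifProg.GuF`), as in `lpTagged`. -/

namespace UnifProg

open Complexity.HashBricks CondRed AffineStr

section L53

variable (f : List Bool → List Bool) (P : Polynomial ℕ)

/-- The parameter-free part `(f, P)` of Lemma 5.3's data, with dummy `α' = γ' = 0`: the bricks of
`L53Prog` that depend on `c = deg P + 3` only (`nOfU`, `totU`, `MU`, `R2U`) are instantiated here.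
[folklore] -/
def L0 : L53Params := ⟨f, P, 0, 0⟩

/-! Input format: `q = ⟨1^{α'}, ⟨1^{γ'}, ⟨1ⁱ, w⟩⟩⟩`. -/

/-- `1^N`, `N = nOf |w|`. [folklore] -/
noncomputable def uN : List Bool → List Bool := L53Prog.nOfU (L0 f P) ∘ sndPow 2
/-- `x = w ↾ N`. [folklore] -/
noncomputable def xN : List Bool → List Bool := takeFn ∘ fanoutFn (uN f P) (sndPow 2)
/-- `w ⇂ N`. [folklore] -/
noncomputable def restN : List Bool → List Bool := dropFn ∘ fanoutFn (uN f P) (sndPow 2)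
/-- `1^{k(N)}`, `k = γ'⌊log₂ N⌋`, with `γ'` read from the input. [folklore] -/
noncomputable def kkN : List Bool → List Bool := umulFn ∘ fanoutFn (nthF 1) (logU ∘ uN f P)
/-- `1^{m(N)}`, `m = 3N^c − k·N`. [folklore] -/
noncomputable def mN : List Bool → List Bool :=
  dropFn ∘ fanoutFn (umulFn ∘ fanoutFn (kkN f P) (uN f P)) (L53Prog.totU (L0 f P) ∘ uN f P)
/-- `ρ = (w ⇂ N) ↾ m(N)`. [folklore] -/
noncomputable def rhoN : List Bool → List Bool := takeFn ∘ fanoutFn (mN f P) (restN f P)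
/-- `σ = (w ⇂ N) ⇂ m(N)`. [folklore] -/
noncomputable def sigN : List Bool → List Bool := dropFn ∘ fanoutFn (mN f P) (restN f P)
/-- `1^{2α'}`, with `α'` read from the input. [folklore] -/
noncomputable def a2N : List Bool → List Bool := umulFn ∘ fanoutFn (fun _ => ones 2) fstF
/-- `1^{L(N)}`, `L = s(N) − 2α'⌊log₂ N⌋`. [folklore] -/
noncomputable def LN : List Bool → List Bool :=
  dropFn ∘ fanoutFn (umulFn ∘ fanoutFn (a2N) (logU ∘ uN f P)) (L53Prog.s53U ∘ uN f P)
/-- `1^a`, `a = min i L(N)` as `L − (L − i)`. [folklore] -/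
noncomputable def aN : List Bool → List Bool := dropFn ∘ fanoutFn (dropFn ∘ fanoutFn (nthF 2) (LN f P)) (LN f P)
/-- `1^b`, `b = L(N) − a`. [folklore] -/
noncomputable def bN : List Bool → List Bool := dropFn ∘ fanoutFn (aN f P) (LN f P)
/-- The first key `ρ ↾ R₁`. [folklore] -/
noncomputable def k1N : List Bool → List Bool := takeFn ∘ fanoutFn (L53Prog.R1U ∘ uN f P) (rhoN f P)
/-- The second key `(ρ ⇂ R₁) ↾ R₂`. [folklore] -/
noncomputable def k2N : List Bool → List Bool :=
  takeFn ∘ fanoutFn (L53Prog.R2U (L0 f P) ∘ uN f P) (dropFn ∘ fanoutFn (L53Prog.R1U ∘ uN f P) (rhoN f P))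
/-- `1^{M(N)}`. [folklore] -/
noncomputable def MN : List Bool → List Bool := L53Prog.MU (L0 f P) ∘ uN f P
/-- `pad N (f x)`. [folklore] -/
noncomputable def padN : List Bool → List Bool :=
  CondGen.fitF (MN f P) (concatFn ∘ fanoutFn (f ∘ xN f P) (fun _ => [true]))
/-- `h¹_{R₁}(x)`. [folklore] -/
noncomputable def h1N : List Bool → List Bool :=
  AffineProg.hashFn ∘ fanoutFn (fanoutFn (uN f P) (aN f P)) (fanoutFn (k1N f P) (xN f P))
/-- `h²_{R₂}(pad (f x))`. [folklore] -/
noncomputable def h2N : List Bool → List Bool :=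
  AffineProg.hashFn ∘ fanoutFn (fanoutFn (MN f P) (bN f P)) (fanoutFn (k2N f P) (padN f P))
/-- **`FFu ⟨1^{α'}, ⟨1^{γ'}, ⟨1ⁱ, w⟩⟩⟩ = f'_i(w)`** for the parameters `(f, P, α', γ')`. [folklore] -/
noncomputable def FFu : List Bool → List Bool :=
  concatFn ∘ fanoutFn (concatFn ∘ fanoutFn (concatFn ∘ fanoutFn (rhoN f P) (h1N f P)) (h2N f P)) (sigN f P)
/-- **`HcFu ⟨1^{α'}, ⟨1^{γ'}, ⟨1ⁱ, w⟩⟩⟩ = GL(w)`** for the parameters `(f, P, α', γ')`. [folklore] -/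
noncomputable def HcFu : List Bool → List Bool :=
  L53Prog.glFn ∘ fanoutFn (fanoutFn (kkN f P) (uN f P)) (fanoutFn (xN f P) (sigN f P))

variable {f P}

/-- **Value of `FFu`.** [folklore] -/
theorem FFu_apply (α' γ' i : ℕ) (w : List Bool) :
    FFu f P (boolPair (ones α') (boolPair (ones γ') (boolPair (ones i) w))) = (L53Params.mk f P α' γ').F i w := by
  have e_nOf : ∀ l, (L53Params.mk f P α' γ').nOf l = (L0 f P).nOf l := fun _ => rfl
  have e_M : ∀ n, (L53Params.mk f P α' γ').M n = (L0 f P).M n := fun _ => rfl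
  have e_R2 : ∀ n, (L53Params.mk f P α' γ').R₂ n = (L0 f P).R₂ n := fun _ => rfl
  have e_m : ∀ n, (L53Params.mk f P α' γ').m n = (L0 f P).tot n - γ' * Nat.log 2 n * n := fun _ => rfl
  have e_L : ∀ n, (L53Params.mk f P α' γ').L n = lpS53 n - 2 * α' * Nat.log 2 n := fun _ => rfl
  have ha : ∀ n, lpS53 n - 2 * α' * Nat.log 2 n - (lpS53 n - 2 * α' * Nat.log 2 n - i) =
      (L53Params.mk f P α' γ').aOf i n := fun _ => L53Prog.sub_sub_eq_min _ _
  simp only [FFu, h1N, h2N, padN, MN, k1N, k2N, aN, bN, LN, a2N, sigN, rhoN, mN, kkN, restN, xN, uN,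
    Function.comp_apply, fanoutFn_apply, fstF_boolPair, nthF_succ_boolPair, nthF_zero_boolPair, sndPow_succ_boolPair,
    sndPow_zero_boolPair, L53Prog.nOfU_apply, L53Prog.totU_apply, L53Prog.s53U_apply, L53Prog.MU_apply,
    L53Prog.R1U_apply, L53Prog.R2U_apply, logU_apply, umulFn_boolPair, List.length_replicate, takeFn_boolPair,
    dropFn_boolPair, concatFn_boolPair, Com.drop_ones, AffineProg.hashFn_boolPair, CondGen.fitF_apply,
    L53Params.F, L53Params.gcore, L53Params.bOf, L53Params.pad, e_nOf, e_M, e_R2, e_m, e_L, ha, List.append_assoc]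

/-- **Value of `HcFu`.** [folklore] -/
theorem HcFu_apply (α' γ' i : ℕ) (w : List Bool) :
    HcFu f P (boolPair (ones α') (boolPair (ones γ') (boolPair (ones i) w))) = (L53Params.mk f P α' γ').Hc w := by
  have e_nOf : ∀ l, (L53Params.mk f P α' γ').nOf l = (L0 f P).nOf l := fun _ => rfl
  have e_m : ∀ n, (L53Params.mk f P α' γ').m n = (L0 f P).tot n - γ' * Nat.log 2 n * n := fun _ => rfl
  simp only [HcFu, kkN, sigN, mN, restN, xN, uN, Function.comp_apply, fanoutFn_apply,
    nthF_succ_boolPair, nthF_zero_boolPair, sndPow_succ_boolPair, sndPow_zero_boolPair, L53Prog.nOfU_apply,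
    L53Prog.totU_apply, logU_apply, umulFn_boolPair, List.length_replicate, takeFn_boolPair, dropFn_boolPair,
    Com.drop_ones, L53Params.Hc, L53Params.kk, e_nOf, e_m]
  exact L53Prog.glFn_boolPair _ _ _ _

/-! #### Efficiency -/

/-- `uN ∈ FP`. [folklore] -/
theorem uN_mem_FP : uN f P ∈ FP := comp_mem_FP L53Prog.nOfU_mem_FP (sndPow_mem_FP 2)
/-- `xN ∈ FP`. [folklore] -/
theorem xN_mem_FP : xN f P ∈ FP := comp_mem_FP takeFn_mem_FP (fanoutFn_mem_FP uN_mem_FP (sndPow_mem_FP 2))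
/-- `restN ∈ FP`. [folklore] -/
theorem restN_mem_FP : restN f P ∈ FP := comp_mem_FP dropFn_mem_FP (fanoutFn_mem_FP uN_mem_FP (sndPow_mem_FP 2))
/-- `kkN ∈ FP`. [folklore] -/
theorem kkN_mem_FP : kkN f P ∈ FP :=
  comp_mem_FP umulFn_mem_FP (fanoutFn_mem_FP (nthF_mem_FP 1) (comp_mem_FP logU_mem_FP uN_mem_FP))
/-- `mN ∈ FP`. [folklore] -/
theorem mN_mem_FP : mN f P ∈ FP :=
  comp_mem_FP dropFn_mem_FP (fanoutFn_mem_FP (comp_mem_FP umulFn_mem_FP (fanoutFn_mem_FP kkN_mem_FP uN_mem_FP))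
    (comp_mem_FP L53Prog.totU_mem_FP uN_mem_FP))
/-- `rhoN ∈ FP`. [folklore] -/
theorem rhoN_mem_FP : rhoN f P ∈ FP := comp_mem_FP takeFn_mem_FP (fanoutFn_mem_FP mN_mem_FP restN_mem_FP)
/-- `sigN ∈ FP`. [folklore] -/
theorem sigN_mem_FP : sigN f P ∈ FP := comp_mem_FP dropFn_mem_FP (fanoutFn_mem_FP mN_mem_FP restN_mem_FP)
/-- `a2N ∈ FP`. [folklore] -/
theorem a2N_mem_FP : a2N ∈ FP := comp_mem_FP umulFn_mem_FP (fanoutFn_mem_FP (const_mem_FP _) fstF_mem_FP)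
/-- `LN ∈ FP`. [folklore] -/
theorem LN_mem_FP : LN f P ∈ FP :=
  comp_mem_FP dropFn_mem_FP (fanoutFn_mem_FP (comp_mem_FP umulFn_mem_FP (fanoutFn_mem_FP a2N_mem_FP
    (comp_mem_FP logU_mem_FP uN_mem_FP))) (comp_mem_FP L53Prog.s53U_mem_FP uN_mem_FP))
/-- `aN ∈ FP`. [folklore] -/
theorem aN_mem_FP : aN f P ∈ FP :=
  comp_mem_FP dropFn_mem_FP (fanoutFn_mem_FP (comp_mem_FP dropFn_mem_FP (fanoutFn_mem_FP (nthF_mem_FP 2) LN_mem_FP)) LN_mem_FP)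
/-- `bN ∈ FP`. [folklore] -/
theorem bN_mem_FP : bN f P ∈ FP := comp_mem_FP dropFn_mem_FP (fanoutFn_mem_FP aN_mem_FP LN_mem_FP)
/-- `k1N ∈ FP`. [folklore] -/
theorem k1N_mem_FP : k1N f P ∈ FP :=
  comp_mem_FP takeFn_mem_FP (fanoutFn_mem_FP (comp_mem_FP L53Prog.R1U_mem_FP uN_mem_FP) rhoN_mem_FP)
/-- `k2N ∈ FP`. [folklore] -/
theorem k2N_mem_FP : k2N f P ∈ FP :=
  comp_mem_FP takeFn_mem_FP (fanoutFn_mem_FP (comp_mem_FP L53Prog.R2U_mem_FP uN_mem_FP)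
    (comp_mem_FP dropFn_mem_FP (fanoutFn_mem_FP (comp_mem_FP L53Prog.R1U_mem_FP uN_mem_FP) rhoN_mem_FP)))
/-- `MN ∈ FP`. [folklore] -/
theorem MN_mem_FP : MN f P ∈ FP := comp_mem_FP L53Prog.MU_mem_FP uN_mem_FP
/-- `padN ∈ FP` for `f ∈ FP`. [folklore] -/
theorem padN_mem_FP (hf : f ∈ FP) : padN f P ∈ FP :=
  CondGen.fitF_mem_FP MN_mem_FP (comp_mem_FP concatFn_mem_FP (fanoutFn_mem_FP (comp_mem_FP hf xN_mem_FP) (const_mem_FP _)))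
/-- `h1N ∈ FP`. [folklore] -/
theorem h1N_mem_FP : h1N f P ∈ FP :=
  comp_mem_FP AffineProg.hashFn_mem_FP (fanoutFn_mem_FP (fanoutFn_mem_FP uN_mem_FP aN_mem_FP) (fanoutFn_mem_FP k1N_mem_FP xN_mem_FP))
/-- `h2N ∈ FP` for `f ∈ FP`. [folklore] -/
theorem h2N_mem_FP (hf : f ∈ FP) : h2N f P ∈ FP :=
  comp_mem_FP AffineProg.hashFn_mem_FP (fanoutFn_mem_FP (fanoutFn_mem_FP MN_mem_FP bN_mem_FP)
    (fanoutFn_mem_FP k2N_mem_FP (padN_mem_FP hf)))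
/-- **`FFu ∈ FP` for `f ∈ FP`.** [folklore] -/
theorem FFu_mem_FP (hf : f ∈ FP) : FFu f P ∈ FP :=
  comp_mem_FP concatFn_mem_FP (fanoutFn_mem_FP (comp_mem_FP concatFn_mem_FP (fanoutFn_mem_FP
    (comp_mem_FP concatFn_mem_FP (fanoutFn_mem_FP rhoN_mem_FP h1N_mem_FP)) (h2N_mem_FP hf))) sigN_mem_FP)
/-- **`HcFu ∈ FP`.** [folklore] -/
theorem HcFu_mem_FP : HcFu f P ∈ FP :=
  comp_mem_FP L53Prog.glFn_mem_FP (fanoutFn_mem_FP (fanoutFn_mem_FP kkN_mem_FP uN_mem_FP)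
    (fanoutFn_mem_FP xN_mem_FP sigN_mem_FP))

end L53

/-! ### The generator of Thm 5.5, uniformly in `(γ, δ)` -/

section Gen

variable (f : List Bool → List Bool) (P : Polynomial ℕ)

/-- `α'(c, δ) = 2(2c + cδ + 1)` (`CondParams.α'`). [folklore] -/
def uAlpha (c δ : ℕ) : ℕ := 2 * (2 * c + c * δ + 1)

/-- `γ'(c, γ, δ) = 2α' + 8(c+1)(γ+1)` (`CondParams.γ'`). [folklore] -/
def uGamma (c γ δ : ℕ) : ℕ := 2 * uAlpha c δ + 8 * (c + 1) * (γ + 1)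

/-- Lemma 5.3's data for the member `(γ, δ)`: `(f, P, α'(c,δ), γ'(c,γ,δ))`, `c = deg P + 3`. [folklore] -/
def uL53 (γ δ : ℕ) : L53Params := ⟨f, P, uAlpha (P.natDegree + 3) δ, uGamma (P.natDegree + 3) γ δ⟩

/-- Thm 5.5's data for the member `(γ, δ)`: `c = deg P + 3`, the regularity index `lpRegIdx f` of
Lemma 5.4, and Lemma 5.3's family `f'_i` and hard-core function `GL` for `(α'(c,δ), γ'(c,γ,δ))`.
[Y. Liu, R. Pass, FOCS 2020, proof of Thm 5.5] [folklore] -/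
noncomputable def uParams (γ δ : ℕ) : CondParams := ⟨P.natDegree + 3, γ, δ, lpRegIdx f, (uL53 f P γ δ).F, (uL53 f P γ δ).Hc⟩

/-- The member `(0, 0)`, carrying the `(γ, δ)`-independent lengths (`seedLen`, `nOfS`). [folklore] -/
noncomputable def Q0 : CondParams := uParams f P 0 0

variable {f P}

/-- `c = deg P + 3`. [folklore] -/
@[simp] theorem uParams_c (γ δ : ℕ) : (uParams f P γ δ).c = P.natDegree + 3 := rfl
/-- The stretch target of the member. [folklore] -/
@[simp] theorem uParams_γ (γ δ : ℕ) : (uParams f P γ δ).γ = γ := rfl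
/-- The security target of the member. [folklore] -/
@[simp] theorem uParams_δ (γ δ : ℕ) : (uParams f P γ δ).δ = δ := rfl
/-- `α'` of the member is `α'(c, δ)`. [folklore] -/
@[simp] theorem uParams_α' (γ δ : ℕ) : (uParams f P γ δ).α' = uAlpha (P.natDegree + 3) δ := rfl
/-- `γ'` of the member is `γ'(c, γ, δ)`. [folklore] -/
@[simp] theorem uParams_γ' (γ δ : ℕ) : (uParams f P γ δ).γ' = uGamma (P.natDegree + 3) γ δ := rfl
/-- `1 ≤ c`. [folklore] -/
theorem one_le_Q0_c : 1 ≤ (Q0 f P).c := by show 1 ≤ P.natDegree + 3; omega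

variable (f P)

/-! Input format: `z = ⟨1^γ, ⟨1^δ, u⟩⟩`. -/

/-- `1^{α'}`, `α' = 2(2c + cδ + 1) = 2c·δ + (4c + 2)`. [folklore] -/
noncomputable def alU : List Bool → List Bool :=
  polyFn (C (2 * (P.natDegree + 3)) * X + C (4 * (P.natDegree + 3) + 2)) ∘ nthF 1
/-- `1^{2α'}`. [folklore] -/
noncomputable def al2U : List Bool → List Bool := umulFn ∘ fanoutFn (fun _ => ones 2) (alU P)
/-- `1^{γ'}`, `γ' = 2α' + 8(c+1)(γ+1)`. [folklore] -/
noncomputable def gaU : List Bool → List Bool :=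
  concatFn ∘ fanoutFn (al2U P) (polyFn (C (8 * (P.natDegree + 3 + 1)) * (X + 1)) ∘ fstF)
/-- `1ⁿ`, `n = nOfS |u|`. [folklore] -/
noncomputable def nU : List Bool → List Bool := CondGen.nOfU (Q0 f P) ∘ sndPow 1
/-- `1^{⌊log₂ n⌋}`. [folklore] -/
noncomputable def lgN : List Bool → List Bool := logU ∘ nU f P
/-- `1^{b n}`, `b n = ⌊log₂ n⌋ + 1`. [folklore] -/
noncomputable def bW : List Bool → List Bool := List.cons true ∘ lgN f P
/-- `1^{seedLen n}`. [folklore] -/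
noncomputable def sLenN : List Bool → List Bool := seedU (Q0 f P).c ∘ nU f P
/-- The designed prefix `v = u ↾ seedLen n`. [folklore] -/
noncomputable def vN : List Bool → List Bool := takeFn ∘ fanoutFn (sLenN f P) (sndPow 1)
/-- The pass-through part `u ⇂ seedLen n`. [folklore] -/
noncomputable def restU : List Bool → List Bool := dropFn ∘ fanoutFn (sLenN f P) (sndPow 1)
/-- The index field `v ↾ b n`. [folklore] -/
noncomputable def idxN : List Bool → List Bool := takeFn ∘ fanoutFn (bW f P) (vN f P)
/-- Lemma 5.3's seed `w = v ⇂ b n`. [folklore] -/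
noncomputable def wN : List Bool → List Bool := dropFn ∘ fanoutFn (bW f P) (vN f P)
/-- The index in unary `1ⁱ`. [folklore] -/
noncomputable def iN : List Bool → List Bool := binToUnaryFn ∘ fanoutFn (polyFn (2 * X + C 2) ∘ nU f P) (idxN f P)
/-- `1^{ℓ n}`. [folklore] -/
noncomputable def ellN : List Bool → List Bool :=
  dropFn ∘ fanoutFn (umulFn ∘ fanoutFn (al2U P) (lgN f P))
    (concatFn ∘ fanoutFn (dropFn ∘ fanoutFn (bW f P) (nU f P)) (polyFn (C 3 * X ^ (Q0 f P).c) ∘ nU f P))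
/-- `1^{γ'⌊log₂ n⌋}`. [folklore] -/
noncomputable def glN : List Bool → List Bool := umulFn ∘ fanoutFn (gaU P) (lgN f P)
/-- The argument `⟨1^{α'}, ⟨1^{γ'}, ⟨1ⁱ, w⟩⟩⟩` handed to `FFu` / `HcFu`. [folklore] -/
noncomputable def argN : List Bool → List Bool := fanoutFn (alU P) (fanoutFn (gaU P) (fanoutFn (iN f P) (wN f P)))
/-- `Gcore n v`. [folklore] -/
noncomputable def gcoreN : List Bool → List Bool :=
  concatFn ∘ fanoutFn (CondGen.fitF (ellN f P) (FFu f P ∘ argN f P)) (CondGen.fitF (glN f P) (HcFu f P ∘ argN f P))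
/-- `1^{|u| + γ⌊log₂ |u|⌋}`, with `γ` read from the input. [folklore] -/
noncomputable def inU : List Bool → List Bool :=
  concatFn ∘ fanoutFn (onesFn ∘ sndPow 1) (umulFn ∘ fanoutFn (onesFn ∘ fstF) (logU ∘ sndPow 1))
/-- **The uniform generator**: `GuF ⟨1^γ, ⟨1^δ, u⟩⟩ = G_{γ,δ}(u)`. [Y. Liu, R. Pass, FOCS 2020, proof of
Thm 5.5 (last paragraph)] [folklore] -/
noncomputable def GuF : List Bool → List Bool :=
  takeFn ∘ fanoutFn inU (concatFn ∘ fanoutFn (gcoreN f P) (restU f P))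

variable {f P}

/-- Value of `alU`. [folklore] -/
theorem alU_apply (z : List Bool) : alU P z = ones (uAlpha (P.natDegree + 3) (nthF 1 z).length) := by
  simp only [alU, Function.comp_apply, polyFn_apply, eval_add, eval_mul, eval_C, eval_X, uAlpha]
  congr 1
  ring

/-- Value of `al2U`. [folklore] -/
theorem al2U_apply (z : List Bool) : al2U P z = ones (2 * uAlpha (P.natDegree + 3) (nthF 1 z).length) := by
  simp only [al2U, Function.comp_apply, fanoutFn_apply, alU_apply, umulFn_boolPair]

/-- Value of `gaU`. [folklore] -/
theorem gaU_apply (z : List Bool) : gaU P z = ones (uGamma (P.natDegree + 3) (fstF z).length (nthF 1 z).length) := by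
  simp only [gaU, Function.comp_apply, fanoutFn_apply, al2U_apply, polyFn_apply, eval_add, eval_mul, eval_C, eval_X,
    eval_one, concatFn_boolPair, Com.ones_append, uGamma]

/-- Value of `inU`. [folklore] -/
theorem inU_apply (z : List Bool) : inU z = ones (lpInner (fstF z).length (sndPow 1 z).length) := by
  simp only [inU, Function.comp_apply, fanoutFn_apply, onesFn_eq_ones, logU_apply, umulFn_boolPair, concatFn_boolPair,
    Com.ones_append, lpInner]

/-- **The uniform pipeline computes the member `(γ, δ)` of the family on `⟨1^γ, ⟨1^δ, u⟩⟩`.**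
[Y. Liu, R. Pass, FOCS 2020, proof of Thm 5.5] [folklore] -/
theorem GuF_apply (a d u : List Bool) : GuF f P (boolPair a (boolPair d u)) = (uParams f P a.length d.length).G u := by
  set Q := uParams f P a.length d.length with hQ
  set n := Q.nOfS u.length with hn
  have hzu : sndPow 1 (boolPair a (boolPair d u)) = u := by
    simp only [sndPow_succ_boolPair, sndPow_zero_boolPair]
  have hzd : nthF 1 (boolPair a (boolPair d u)) = d := by
    simp only [nthF_succ_boolPair, nthF_zero_boolPair]
  have hN : nU f P (boolPair a (boolPair d u)) = ones n := by
    simp only [nU, Function.comp_apply, hzu]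
    exact CondGen.nOfU_apply one_le_Q0_c u
  have hlg : lgN f P (boolPair a (boolPair d u)) = ones (Nat.log 2 n) := by
    simp only [lgN, Function.comp_apply, hN, logU_apply, List.length_replicate]
  have hb : bW f P (boolPair a (boolPair d u)) = ones (CondParams.b n) := by
    simp only [bW, Function.comp_apply, hlg, true_cons_ones, CondParams.b]
  have hsl : sLenN f P (boolPair a (boolPair d u)) = ones (Q.seedLen n) := by
    simp only [sLenN, Function.comp_apply, hN, seedU_apply, List.length_replicate]
    rfl
  have hv : vN f P (boolPair a (boolPair d u)) = u.take (Q.seedLen n) := by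
    simp only [vN, Function.comp_apply, fanoutFn_apply, hsl, hzu, takeFn_boolPair, List.length_replicate]
  have hrest : restU f P (boolPair a (boolPair d u)) = u.drop (Q.seedLen n) := by
    simp only [restU, Function.comp_apply, fanoutFn_apply, hsl, hzu, dropFn_boolPair, List.length_replicate]
  have hidx : idxN f P (boolPair a (boolPair d u)) = (u.take (Q.seedLen n)).take (CondParams.b n) := by
    simp only [idxN, Function.comp_apply, fanoutFn_apply, hb, hv, takeFn_boolPair, List.length_replicate]
  have hw : wN f P (boolPair a (boolPair d u)) = (u.take (Q.seedLen n)).drop (CondParams.b n) := by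
    simp only [wN, Function.comp_apply, fanoutFn_apply, hb, hv, dropFn_boolPair, List.length_replicate]
  have hruler : (polyFn (2 * X + C 2) (nU f P (boolPair a (boolPair d u)))).length = 2 * n + 2 := by
    rw [hN, polyFn_apply, List.length_replicate, List.length_replicate, eval_add, eval_mul, eval_ofNat, eval_X, eval_C]
  have hi : iN f P (boolPair a (boolPair d u)) = ones (bitsToNat ((u.take (Q.seedLen n)).take (CondParams.b n))) := by
    have h1 : iN f P (boolPair a (boolPair d u)) =
        ones (min (bitsToNat (idxN f P (boolPair a (boolPair d u)))) (polyFn (2 * X + C 2) (nU f P (boolPair a (boolPair d u)))).length) := by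
      simp only [iN, Function.comp_apply, fanoutFn_apply, binToUnaryFn_boolPair]
    have hle : bitsToNat ((u.take (Q.seedLen n)).take (CondParams.b n)) ≤ 2 * n + 2 :=
      Nat.le_of_lt ((bitsToNat_lt _).trans_le
        ((Nat.pow_le_pow_right (by norm_num) (List.length_take_le _ _)).trans (CondGen.two_pow_b_le n)))
    rw [h1, hruler, hidx, Nat.min_eq_left hle]
  have hpc : polyFn (C 3 * X ^ (Q0 f P).c) (ones n) = ones (3 * n ^ Q.c) := by
    rw [polyFn_apply, List.length_replicate, eval_mul, eval_C, eval_pow, eval_X]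
    rfl
  have hell : ellN f P (boolPair a (boolPair d u)) = ones (Q.ℓ n) := by
    have h1 : ellN f P (boolPair a (boolPair d u)) =
        ((ones n).drop (CondParams.b n) ++ ones (3 * n ^ Q.c)).drop (2 * Q.α' * Nat.log 2 n) := by
      simp only [ellN, Function.comp_apply, fanoutFn_apply, hlg, hb, hN, hpc, al2U_apply, hzd, umulFn_boolPair,
        dropFn_boolPair, List.length_replicate, concatFn_boolPair, hQ, uParams_α']
    rw [h1, Com.drop_ones, Com.ones_append, Com.drop_ones]
    unfold CondParams.ℓ lpLen53 lpS53 CondParams.b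
    exact congrArg ones (by omega)
  have hgl : glN f P (boolPair a (boolPair d u)) = ones (Q.γ' * Nat.log 2 n) := by
    simp only [glN, Function.comp_apply, fanoutFn_apply, hlg, gaU_apply, fstF_boolPair, hzd, umulFn_boolPair, hQ,
      uParams_γ']
  have harg : argN f P (boolPair a (boolPair d u)) = boolPair (ones Q.α') (boolPair (ones Q.γ')
      (boolPair (ones (bitsToNat ((u.take (Q.seedLen n)).take (CondParams.b n)))) ((u.take (Q.seedLen n)).drop (CondParams.b n)))) := by
    simp only [argN, fanoutFn_apply, alU_apply, gaU_apply, fstF_boolPair, hzd, hi, hw, hQ, uParams_α', uParams_γ']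
  have hf : FFu f P (argN f P (boolPair a (boolPair d u))) =
      Q.F (bitsToNat ((u.take (Q.seedLen n)).take (CondParams.b n))) ((u.take (Q.seedLen n)).drop (CondParams.b n)) := by
    rw [harg, FFu_apply]
    rfl
  have hH : HcFu f P (argN f P (boolPair a (boolPair d u))) = Q.Hc ((u.take (Q.seedLen n)).drop (CondParams.b n)) := by
    rw [harg, HcFu_apply]
    rfl
  have hcore : gcoreN f P (boolPair a (boolPair d u)) = Q.Gcore n (u.take (Q.seedLen n)) := by
    simp only [gcoreN, Function.comp_apply, fanoutFn_apply, CondGen.fitF_apply, hell, hgl, hf, hH, List.length_replicate,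
      concatFn_boolPair, CondParams.Gcore]
  simp only [GuF, Function.comp_apply, fanoutFn_apply, inU_apply, fstF_boolPair, hzu, hcore, hrest, concatFn_boolPair,
    takeFn_boolPair, List.length_replicate, CondParams.G, padGen, hn, hQ, uParams_γ]

/-! #### Efficiency -/

/-- `alU ∈ FP`. [folklore] -/
theorem alU_mem_FP : alU P ∈ FP := comp_mem_FP (polyFn_mem_FP _) (nthF_mem_FP 1)
/-- `al2U ∈ FP`. [folklore] -/
theorem al2U_mem_FP : al2U P ∈ FP := comp_mem_FP umulFn_mem_FP (fanoutFn_mem_FP (const_mem_FP _) alU_mem_FP)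
/-- `gaU ∈ FP`. [folklore] -/
theorem gaU_mem_FP : gaU P ∈ FP :=
  comp_mem_FP concatFn_mem_FP (fanoutFn_mem_FP al2U_mem_FP (comp_mem_FP (polyFn_mem_FP _) fstF_mem_FP))
/-- `nU ∈ FP`. [folklore] -/
theorem nU_mem_FP : nU f P ∈ FP := comp_mem_FP CondGen.nOfU_mem_FP (sndPow_mem_FP 1)
/-- `lgN ∈ FP`. [folklore] -/
theorem lgN_mem_FP : lgN f P ∈ FP := comp_mem_FP logU_mem_FP nU_mem_FP
/-- `bW ∈ FP`. [folklore] -/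
theorem bW_mem_FP : bW f P ∈ FP := comp_mem_FP (cons_mem_FP true) lgN_mem_FP
/-- `sLenN ∈ FP`. [folklore] -/
theorem sLenN_mem_FP : sLenN f P ∈ FP := comp_mem_FP (seedU_mem_FP _) nU_mem_FP
/-- `vN ∈ FP`. [folklore] -/
theorem vN_mem_FP : vN f P ∈ FP := comp_mem_FP takeFn_mem_FP (fanoutFn_mem_FP sLenN_mem_FP (sndPow_mem_FP 1))
/-- `restU ∈ FP`. [folklore] -/
theorem restU_mem_FP : restU f P ∈ FP := comp_mem_FP dropFn_mem_FP (fanoutFn_mem_FP sLenN_mem_FP (sndPow_mem_FP 1))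
/-- `idxN ∈ FP`. [folklore] -/
theorem idxN_mem_FP : idxN f P ∈ FP := comp_mem_FP takeFn_mem_FP (fanoutFn_mem_FP bW_mem_FP vN_mem_FP)
/-- `wN ∈ FP`. [folklore] -/
theorem wN_mem_FP : wN f P ∈ FP := comp_mem_FP dropFn_mem_FP (fanoutFn_mem_FP bW_mem_FP vN_mem_FP)
/-- `iN ∈ FP`. [folklore] -/
theorem iN_mem_FP : iN f P ∈ FP :=
  comp_mem_FP binToUnaryFn_mem_FP (fanoutFn_mem_FP (comp_mem_FP (polyFn_mem_FP _) nU_mem_FP) idxN_mem_FP)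
/-- `ellN ∈ FP`. [folklore] -/
theorem ellN_mem_FP : ellN f P ∈ FP :=
  comp_mem_FP dropFn_mem_FP (fanoutFn_mem_FP (comp_mem_FP umulFn_mem_FP (fanoutFn_mem_FP al2U_mem_FP lgN_mem_FP))
    (comp_mem_FP concatFn_mem_FP (fanoutFn_mem_FP (comp_mem_FP dropFn_mem_FP (fanoutFn_mem_FP bW_mem_FP nU_mem_FP))
      (comp_mem_FP (polyFn_mem_FP _) nU_mem_FP))))
/-- `glN ∈ FP`. [folklore] -/
theorem glN_mem_FP : glN f P ∈ FP := comp_mem_FP umulFn_mem_FP (fanoutFn_mem_FP gaU_mem_FP lgN_mem_FP)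
/-- `argN ∈ FP`. [folklore] -/
theorem argN_mem_FP : argN f P ∈ FP :=
  fanoutFn_mem_FP alU_mem_FP (fanoutFn_mem_FP gaU_mem_FP (fanoutFn_mem_FP iN_mem_FP wN_mem_FP))
/-- `gcoreN ∈ FP` for `f ∈ FP`. [folklore] -/
theorem gcoreN_mem_FP (hf : f ∈ FP) : gcoreN f P ∈ FP :=
  comp_mem_FP concatFn_mem_FP (fanoutFn_mem_FP
    (CondGen.fitF_mem_FP ellN_mem_FP (comp_mem_FP (FFu_mem_FP hf) argN_mem_FP))
    (CondGen.fitF_mem_FP glN_mem_FP (comp_mem_FP HcFu_mem_FP argN_mem_FP)))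
/-- `inU ∈ FP`. [folklore] -/
theorem inU_mem_FP : inU ∈ FP :=
  comp_mem_FP concatFn_mem_FP (fanoutFn_mem_FP (comp_mem_FP onesFn_mem_FP (sndPow_mem_FP 1))
    (comp_mem_FP umulFn_mem_FP (fanoutFn_mem_FP (comp_mem_FP onesFn_mem_FP fstF_mem_FP)
      (comp_mem_FP logU_mem_FP (sndPow_mem_FP 1)))))
/-- **`GuF ∈ FP` for `f ∈ FP`**: one polynomial-time function computes the whole family.
[Y. Liu, R. Pass, FOCS 2020, proof of Thm 5.5 (last paragraph)] [folklore] -/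
theorem GuF_mem_FP (hf : f ∈ FP) : GuF f P ∈ FP :=
  comp_mem_FP takeFn_mem_FP (fanoutFn_mem_FP inU_mem_FP (comp_mem_FP concatFn_mem_FP
    (fanoutFn_mem_FP (gcoreN_mem_FP hf) restU_mem_FP)))

end Gen

/-! ### Assembly: Thm 5.5 with its running-time clause -/

section Assembly

open Filter

variable {f : List Bool → List Bool} {P : Polynomial ℕ}

/-- **The tagged members of the uniform generator are the generators of Thm 5.5**:
`s ↦ GuF ⟨1^γ, ⟨1^δ, s⟩⟩` is `CondParams.G` for the data `uParams f P γ δ`. [folklore] -/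
theorem lpTagged_GuF (f : List Bool → List Bool) (P : Polynomial ℕ) (γ δ : ℕ) :
    lpTagged (GuF f P) γ δ = (uParams f P γ δ).G := by
  funext s
  rw [lpTagged, unaryEncodeNat_eq_ones, unaryEncodeNat_eq_ones, GuF_apply, List.length_replicate, List.length_replicate]

/-- **Each member is a cond EP-PRG** (the proof of Thm 5.5 for the explicit data `uParams f P γ δ`):
for a one-way `f` with `|f x| ≤ P(|x|)` and `δ ≥ 1`, `G_{γ,δ}` is a `1/n^δ`-cond EP-PRG of stretch
`γ⌊log₂ n⌋` with events `E` and entropy loss `γ' + 2` — Lemma 5.4 (`lpRegSet`, saturated), the five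
clauses of Lemma 5.3 for `L53Params` (lengths, density, pseudorandomness from the Goldreich–Levin
theorem `GLInv.goldreichLevin_hiding_len_of_eff`), and `CondParams.entropy_G` / `pseudorandom_G`.
[Y. Liu, R. Pass, FOCS 2020, Thm 5.5 (proof)] [cite: LiuPassFOCS2020, Thm 5.5 (proof)] -/
theorem isCondEPPRG_uParams (hf : IsOneWay f) (hP : ∀ x : List Bool, (f x).length ≤ P.eval x.length) (γ : ℕ) {δ : ℕ}
    (hδ : 1 ≤ δ) :
    IsCondEPPRG (fun n : ℕ => 1 / (n : ℝ) ^ δ) (uParams f P γ δ).G ((uParams f P γ δ).E (lpRegSet f)) (lpInner γ)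
      ((uParams f P γ δ).γ' + 2) := by
  have hS : IsSOWF f (lpRegSet f) := isSOWF_lpRegSet hf
  have hreg : IsRegularOver f (lpRegSet f) (lpRegIdx f) := fun n x hx => preimCard_of_mem_lpRegSet hx
  have hsat : IsSaturated f (lpRegSet f) := isSaturated_lpRegSet f
  have hdense : ∀ n, 1 ≤ n → 2 ^ n ≤ n * (lpRegSet f n).card := fun n hn => card_lpRegSet f hn
  have hGL : goldreichLevin_hiding_len := GLInv.goldreichLevin_hiding_len_of_eff GLInv.glInvRun_polyTime_holds
  set Q := uParams f P γ δ
  set L := uL53 f P γ δ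
  have hc : 1 ≤ Q.c := by show 1 ≤ P.natDegree + 3; omega
  have H : Q.Hyps (lpRegSet f) := ⟨hc, lpRegIdx_le f, hdense, L.eventually_lengths (lpRegSet f) (lpRegIdx f),
    L.eventually_density (lpRegSet f) (lpRegIdx f) hP (fun n x hx => (hreg n x hx).2) hdense⟩
  refine ⟨condGen_polyTime_holds Q hc (L.F_mem_FP hS.1) L.Hc_mem_FP, fun N => Q.E_spec (lpRegSet f) N, Q.length_G hc,
    ?_, ?_⟩
  · intro D hD
    exact CondParams.pseudorandom_G H hδ (fun D hD => L.eventually_pseudorandom hGL hS hreg hsat hP hdense D hD)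
      (fun D' qD cl hD' _ hcl => Q.isPPT_red_of condRedRun_polyTime_holds D' qD cl hD' hcl) D hD
  · exact CondParams.entropy_G H

end Assembly

end UnifProg

/-- **Liu–Pass 2020, Thm 5.5 with its running-time clause, proved** (discharge of the named fact
`condEPPRG_uniform_of_OWFExist` of `LiuPassCondFamily.lean`): if one-way functions exist, there is a
single polynomial-time `Gu` such that for all `γ, δ > 1` the member `s ↦ Gu⟨1^γ, ⟨1^δ, s⟩⟩` is a
`1/n^δ`-cond EP-PRG of output length `n + γ⌊log₂ n⌋`. Proof as printed (arXiv:2009.11514, proof of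
Thm 5.5, last paragraph: "there exists some polynomial `t₀(n')` such that for every `δ, γ > 1`,
`(γ + δ)t₀(n')` bounds the running time of `G'_{δ,γ}` … for any `γ, δ`, `G'` runs in
`poly(n) + O(n^{c+1}) + (γ+δ)O(n^c log n)` time"): the construction of §5.3 — Lemma 5.4's regular sets
(`lpRegSet`), Lemma 5.3's hashed family `f'_i` and Goldreich–Levin bits (`L53Params`, with the
Goldreich–Levin theorem proved in the tree, `GLInv.goldreichLevin_hiding_len_of_eff`), the generator
`G_{δ,γ}` extended to all lengths (`CondParams.G`) — is computed by ONE `FP` pipeline `UnifProg.GuF f P`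
reading `γ, δ` in unary from its input (`UnifProg.GuF_apply`, `UnifProg.GuF_mem_FP`); each member is a
cond EP-PRG by the tree's proof of Thm 5.5 (`UnifProg.isCondEPPRG_uParams`). `Gu` is chosen after the
one-way function `f` and a polynomial bound `P` on its output length, as print's `t₀` is.
[Y. Liu, R. Pass, FOCS 2020, Thm 5.5 and its proof (last paragraph); arXiv:2009.11514v1, §5.3, pp. 14–15]
[cite: LiuPassFOCS2020, Thm 5.5 (with the running-time clause, as established in its proof)] -/
theorem condEPPRG_uniform_of_OWFExist_holds : condEPPRG_uniform_of_OWFExist := by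
  intro hOWF
  obtain ⟨f, hf⟩ := hOWF
  have hfP : f ∈ FP := (isSOWF_lpRegSet hf).1
  obtain ⟨P, hP⟩ := exists_poly_length_le_of_mem_FP hfP
  refine ⟨UnifProg.GuF f P, UnifProg.GuF_mem_FP hfP, fun γ δ _ hδ => ?_⟩
  refine ⟨(UnifProg.uParams f P γ δ).E (lpRegSet f), (UnifProg.uParams f P γ δ).γ' + 2, ?_⟩
  rw [UnifProg.lpTagged_GuF]
  exact UnifProg.isCondEPPRG_uParams hf hP γ hδ.le

/-- **Liu–Pass 2020, Thm 5.5 (without the running-time clause), proved**: discharge of the named fact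
`condEPPRG_of_OWFExist` of `LiuPassPadding.lean`, from the uniform form
(`condEPPRG_of_OWFExist_of_uniform`). [Y. Liu, R. Pass, FOCS 2020, Thm 5.5] [cite: LiuPassFOCS2020, Thm 5.5] -/
theorem condEPPRG_of_OWFExist_holds : condEPPRG_of_OWFExist :=
  condEPPRG_of_OWFExist_of_uniform condEPPRG_uniform_of_OWFExist_holds

/-- **Liu–Pass 2020, Thm 5.6 with the truncations and eq. (2) of the proof of Thm 5.2 — the covering
family of cond EP-PRGs for the tree's universal machine — proved**: discharge of the named fact
`condEPPRG_family_of_OWFExist` of `LiuPassCondEPPRG.lean` (`condEPPRG_family_of_OWFExist_of_uniform` with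
Thm 5.5's running-time clause now proved). [Y. Liu, R. Pass, FOCS 2020, Thm 5.6; proof of Thm 5.2 (¶1,
eq. (2))] [cite: LiuPassFOCS2020, Thm 5.6] -/
theorem condEPPRG_family_of_OWFExist_holds : condEPPRG_family_of_OWFExist :=
  condEPPRG_family_of_OWFExist_of_uniform condEPPRG_uniform_of_OWFExist_holds

end Literature.Computability.Cryptography
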